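import Literature.Probability.Percolation.BoxCrossingProofs

/-!
# The timed lattice walk of a finely sampled loop

Support file for `RectilinearSuffices` / `Assembly` (route CardyBoundaryCoulombGas of
`CardyFormulaZ2`, items stmt-CriticalPhenomena-5663 / 13894), second file of the grid-polygon
approximation of a Jordan curve.

Given a loop `γ : ℝ → ℂ` with `γ 1 = γ 0`, a mesh `h > 0` and `N ≥ 1` such that parameters at
most `1/N` apart have `γ`-values at most `h/4` apart, we snap the samples `γ (i/N)` to the lattice
`hℤ²` (`nearestSite`) and expand diagonal (king) moves into two axis (rook) moves, obtaining a
*timed lattice walk* `w₀ :: W` (`exists_timed_lattice_walk`): consecutive sites equal or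
`ℤ²`-adjacent, times strictly increasing by at most `1/N`, starting at time `0` and ending at
time `1` at the starting site, every element `(v, t)` having `dist (h v) (γ t) ≤ 3 h`. This is the
input of the short-loop erasure (`ShortLoopErasure.exists_cycle_of_timed_walk`). Also: adjacency of `ℤ²`
in coordinates (`coord_of_zdGraph_adj`) and axis-parallelism of mesh edges.
-/

noncomputable section

namespace Summit.CriticalPhenomena.CardyFormulaZ2.Theorems

namespace RectilinearApproximation

open Set Metric List
open Literature.Probability.LatticeModels Literature.Probability.Percolation

/-- Rounding is `1`-Lipschitz up to the grid: `|a - b| ≤ 1/2` gives `|round a - round b| ≤ 1`.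
[folklore] -/
theorem abs_round_sub_round_le_one {a b : ℝ} (h : |a - b| ≤ 1 / 2) :
    |round a - round b| ≤ (1 : ℤ) := by
  have ha := abs_le.1 (abs_sub_round a)
  have hb := abs_le.1 (abs_sub_round b)
  have h' := abs_le.1 h
  have key : |((round a : ℤ) : ℝ) - round b| < 2 := by
    rw [abs_lt]
    constructor <;> linarith [ha.1, ha.2, hb.1, hb.2, h'.1, h'.2]
  have key' : |round a - round b| < (2 : ℤ) := by exact_mod_cast key
  have := abs_lt.1 key'
  rw [abs_le]
  omega

/-- The coordinates of the nearest site of nearby points differ by at most one. [folklore] -/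
theorem abs_nearestSite_sub_le_one {h : ℝ} (hh : 0 < h) {z w : ℂ} (hzw : dist z w ≤ h / 2)
    (i : Fin 2) : |nearestSite h z i - nearestSite h w i| ≤ 1 := by
  have hre : |z.re - w.re| ≤ h / 2 := by
    have := Complex.abs_re_le_norm (z - w)
    rw [Complex.sub_re] at this
    rw [dist_eq_norm] at hzw
    exact this.trans hzw
  have him : |z.im - w.im| ≤ h / 2 := by
    have := Complex.abs_im_le_norm (z - w)
    rw [Complex.sub_im] at this
    rw [dist_eq_norm] at hzw
    exact this.trans hzw
  have hdiv : ∀ {a b : ℝ}, |a - b| ≤ h / 2 → |a / h - b / h| ≤ 1 / 2 := fun {a b} hab => by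
    rw [← sub_div, abs_div, abs_of_pos hh, div_le_iff₀ hh]
    linarith
  fin_cases i
  · exact abs_round_sub_round_le_one (hdiv hre)
  · exact abs_round_sub_round_le_one (hdiv him)

/-- Adjacency in `ℤ²` from the coordinates: same second coordinate, first coordinates one apart.
[folklore] -/
theorem zdGraph_adj_of_coord_zero {x y : Site 2} (h0 : y 0 = x 0 + 1 ∨ x 0 = y 0 + 1)
    (h1 : y 1 = x 1) : (zdGraph 2).Adj x y := by
  rw [zdGraph_adj_iff]
  refine ⟨0, ?_⟩
  rcases h0 with h0 | h0
  · left
    funext j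
    fin_cases j <;> simp [h0, h1]
  · right
    funext j
    fin_cases j <;> simp [h0, h1]

/-- Adjacency in `ℤ²` from the coordinates: same first coordinate, second coordinates one apart.
[folklore] -/
theorem zdGraph_adj_of_coord_one {x y : Site 2} (h1 : y 1 = x 1 + 1 ∨ x 1 = y 1 + 1)
    (h0 : y 0 = x 0) : (zdGraph 2).Adj x y := by
  rw [zdGraph_adj_iff]
  refine ⟨1, ?_⟩
  rcases h1 with h1 | h1
  · left
    funext j
    fin_cases j <;> simp [h0, h1]
  · right
    funext j
    fin_cases j <;> simp [h0, h1]

/-- **The timed lattice walk of a finely sampled loop.** Let `γ : ℝ → ℂ` satisfy `γ 1 = γ 0`,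
let `h > 0`, `N ≥ 1`, and suppose `dist (γ s) (γ t) ≤ h/4` whenever `s, t ∈ [0, 1]`,
`|s - t| ≤ 1/N`. Then there is a timed walk `w₀ :: W` on `ℤ²` — consecutive sites equal or
adjacent, times strictly increasing by at most `1/N` — with `w₀ = (v₀, 0)`, nonempty `W` ending
at `(v₀, 1)`, all times in `[0, 1]`, and `dist (meshPoint h v) (γ t) ≤ 3 h` for every element
`(v, t)` (samples `γ (i/N)` snapped to `hℤ²` by `nearestSite`, king moves expanded into two rook
moves through the corner `(x', y)` at the half-time). [folklore] -/
theorem exists_timed_lattice_walk (γ : ℝ → ℂ) {h : ℝ} (hh : 0 < h) {N : ℕ} (hN : 1 ≤ N)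
    (hmod : ∀ s ∈ Icc (0 : ℝ) 1, ∀ t ∈ Icc (0 : ℝ) 1, |s - t| ≤ 1 / N → dist (γ s) (γ t) ≤ h / 4)
    (hloop : γ 1 = γ 0) :
    ∃ (w₀ : Site 2 × ℝ) (W : List (Site 2 × ℝ)) (hW : W ≠ []),
      (w₀ :: W).IsChain (fun a b => (a.1 = b.1 ∨ (zdGraph 2).Adj a.1 b.1) ∧ a.2 < b.2 ∧
        b.2 ≤ a.2 + 1 / (N : ℝ)) ∧
      w₀.2 = 0 ∧ (W.getLast hW).1 = w₀.1 ∧ (W.getLast hW).2 = 1 ∧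
      ∀ e ∈ w₀ :: W, e.2 ∈ Icc (0 : ℝ) 1 ∧ dist (meshPoint h e.1) (γ e.2) ≤ 3 * h := by
  have hN' : (0 : ℝ) < N := by exact_mod_cast hN
  -- the snapped samples
  set v : ℕ → Site 2 := fun i => nearestSite h (γ (i / N)) with hv
  have hvclose : ∀ i : ℕ, dist (meshPoint h (v i)) (γ (i / N)) ≤ h := fun i =>
    dist_meshPoint_nearestSite_le hh _
  have hmemI : ∀ i : ℕ, i ≤ N → ((i : ℝ) / N) ∈ Icc (0 : ℝ) 1 := fun i hi =>
    ⟨by positivity, by rw [div_le_one hN']; exact_mod_cast hi⟩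
  -- consecutive samples are king-adjacent
  have hking : ∀ i : ℕ, i + 1 ≤ N → ∀ c : Fin 2, |v (i + 1) c - v i c| ≤ 1 := by
    intro i hi c
    apply abs_nearestSite_sub_le_one hh
    refine (hmod _ (hmemI _ hi) _ (hmemI _ (by omega)) ?_).trans (by linarith)
    rw [Nat.cast_succ, add_div, add_sub_cancel_left, abs_of_pos (by positivity)]
  -- the walk covering the samples `i, …, i + k`, by induction on `k`
  have main : ∀ k i : ℕ, i + k ≤ N → ∃ (L : List (Site 2 × ℝ)) (hL : L ≠ []),
      L.head hL = (v i, (i : ℝ) / N) ∧ L.getLast hL = (v (i + k), ((i + k : ℕ) : ℝ) / N) ∧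
      L.IsChain (fun a b => (a.1 = b.1 ∨ (zdGraph 2).Adj a.1 b.1) ∧ a.2 < b.2 ∧
        b.2 ≤ a.2 + 1 / (N : ℝ)) ∧
      ∀ e ∈ L, e.2 ∈ Icc ((i : ℝ) / N) (((i + k : ℕ) : ℝ) / N) ∧
        dist (meshPoint h e.1) (γ e.2) ≤ 3 * h := by
    intro k
    induction k with
    | zero =>
      intro i _
      refine ⟨[(v i, (i : ℝ) / N)], cons_ne_nil _ _, rfl, by simp, isChain_singleton _, ?_⟩
      intro e he
      simp only [List.mem_singleton] at he
      subst he
      exact ⟨⟨le_rfl, by simp⟩, (hvclose i).trans (by linarith)⟩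
    | succ k ih =>
      intro i hik
      obtain ⟨L, hL, hhead, hlast, hchain, hmem⟩ := ih (i + 1) (by omega)
      have hi1 : i + 1 ≤ N := by omega
      have hk0 := hking i hi1 0
      have hk1 := hking i hi1 1
      rw [abs_le] at hk0 hk1
      have hcast : ((i + 1 : ℕ) : ℝ) / N = (i : ℝ) / N + 1 / N := by push_cast; ring
      have hcast' : ((i + 1 + k : ℕ) : ℝ) = ((i + (k + 1) : ℕ) : ℝ) := by push_cast; ring
      obtain ⟨e₁, L', rfl⟩ : ∃ e₁ L', L = e₁ :: L' := exists_cons_of_ne_nil hL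
      simp only [head_cons] at hhead
      subst hhead
      -- times and closeness bookkeeping for the new elements
      have ht0 : ((i : ℝ) / N) ∈ Icc ((i : ℝ) / N) (((i + (k + 1) : ℕ) : ℝ) / N) :=
        ⟨le_rfl, by gcongr; linarith⟩
      have hmem' : ∀ e ∈ (v (i + 1), ((i + 1 : ℕ) : ℝ) / N) :: L',
          e.2 ∈ Icc ((i : ℝ) / N) (((i + (k + 1) : ℕ) : ℝ) / N) ∧
            dist (meshPoint h e.1) (γ e.2) ≤ 3 * h := by
        intro e he
        obtain ⟨⟨h1, h2⟩, h3⟩ := hmem e he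
        have hNinv : (0 : ℝ) ≤ 1 / N := by positivity
        refine ⟨⟨le_trans (by rw [hcast]; linarith) h1, by rwa [← hcast']⟩, h3⟩
      by_cases hdiag : v (i + 1) 0 ≠ v i 0 ∧ v (i + 1) 1 ≠ v i 1
      · -- king move: insert the corner `(x', y)` at the half-time
        set m : Site 2 := ![v (i + 1) 0, v i 1] with hm
        set tm : ℝ := ((i : ℝ) + 1 / 2) / N with htm
        have hadj1 : (zdGraph 2).Adj (v i) m := by
          refine zdGraph_adj_of_coord_zero ?_ (by simp [hm])
          simp only [hm, Matrix.cons_val_zero]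
          rcases hdiag with ⟨h0, -⟩
          omega
        have hadj2 : (zdGraph 2).Adj m (v (i + 1)) := by
          refine zdGraph_adj_of_coord_one ?_ (by simp [hm])
          simp only [hm, Matrix.cons_val_one, Matrix.cons_val_zero]
          rcases hdiag with ⟨-, h1⟩
          omega
        refine ⟨(v i, (i : ℝ) / N) :: (m, tm) :: (v (i + 1), ((i + 1 : ℕ) : ℝ) / N) :: L',
          cons_ne_nil _ _, rfl, ?_, ?_, ?_⟩
        · rw [getLast_cons (cons_ne_nil _ _), getLast_cons (cons_ne_nil _ _), hlast, hcast']
          simp [Nat.add_assoc, Nat.add_comm 1 k]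
        · refine isChain_cons_cons.2 ⟨⟨Or.inr hadj1, ?_, ?_⟩, isChain_cons_cons.2 ⟨⟨Or.inr hadj2, ?_, ?_⟩, hchain⟩⟩
          · show (i : ℝ) / N < ((i : ℝ) + 1 / 2) / N
            gcongr; linarith
          · show ((i : ℝ) + 1 / 2) / N ≤ (i : ℝ) / N + 1 / N
            rw [add_div]; gcongr; linarith
          · show ((i : ℝ) + 1 / 2) / N < ((i + 1 : ℕ) : ℝ) / N
            push_cast; gcongr; linarith
          · show ((i + 1 : ℕ) : ℝ) / N ≤ ((i : ℝ) + 1 / 2) / N + 1 / N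
            push_cast; rw [← add_div]; gcongr; linarith
        · intro e he
          rcases mem_cons.1 he with rfl | he
          · exact ⟨ht0, (hvclose i).trans (by linarith)⟩
          rcases mem_cons.1 he with rfl | he
          · refine ⟨⟨?_, ?_⟩, ?_⟩
            · show (i : ℝ) / N ≤ ((i : ℝ) + 1 / 2) / N
              gcongr; linarith
            · show ((i : ℝ) + 1 / 2) / N ≤ ((i + (k + 1) : ℕ) : ℝ) / N
              gcongr; push_cast; linarith
            · -- `dist (h m) (γ tm) ≤ dist (h m) (h v_{i+1}) + dist (h v_{i+1}, γ t_{i+1}) + h/4`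
              have h1 : dist (meshPoint h m) (meshPoint h (v (i + 1))) = h := by
                rw [dist_meshPoint_of_adj hadj2, abs_of_pos hh]
              have h2 := hvclose (i + 1)
              have h3 : dist (γ (((i + 1 : ℕ) : ℝ) / N)) (γ tm) ≤ h / 4 := by
                refine hmod _ (hmemI _ hi1) _ ⟨by positivity, ?_⟩ ?_
                · rw [htm, div_le_one hN']
                  have : (i : ℝ) + 1 ≤ N := by exact_mod_cast hi1
                  linarith
                · rw [htm]; push_cast
                  rw [← sub_div, abs_div, abs_of_pos hN']
                  rw [show (i : ℝ) + 1 - (i + 1 / 2) = 1 / 2 by ring, abs_of_pos (by norm_num)]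
                  gcongr; norm_num
              have h2' : dist (meshPoint h (v (i + 1))) (γ (((i + 1 : ℕ) : ℝ) / N)) ≤ h := by
                have := hvclose (i + 1); push_cast at this ⊢; exact this
              calc dist (meshPoint h m) (γ tm)
                  ≤ dist (meshPoint h m) (meshPoint h (v (i + 1))) +
                      dist (meshPoint h (v (i + 1))) (γ (((i + 1 : ℕ) : ℝ) / N)) +
                      dist (γ (((i + 1 : ℕ) : ℝ) / N)) (γ tm) := dist_triangle4 _ _ _ _
                _ ≤ h + h + h / 4 := by gcongr; exact h1.le
                _ ≤ 3 * h := by linarith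
          · exact hmem' e he
      · -- rook move or no move
        have hstep : v i = v (i + 1) ∨ (zdGraph 2).Adj (v i) (v (i + 1)) := by
          by_cases h0 : v (i + 1) 0 = v i 0
          · by_cases h1 : v (i + 1) 1 = v i 1
            · left
              funext j
              fin_cases j
              · exact h0.symm
              · exact h1.symm
            · right
              exact zdGraph_adj_of_coord_one (by omega) h0
          · have h1 : v (i + 1) 1 = v i 1 := by
              by_contra h1
              exact hdiag ⟨h0, h1⟩
            right
            exact zdGraph_adj_of_coord_zero (by omega) h1
        refine ⟨(v i, (i : ℝ) / N) :: (v (i + 1), ((i + 1 : ℕ) : ℝ) / N) :: L', cons_ne_nil _ _,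
          rfl, ?_, ?_, ?_⟩
        · rw [getLast_cons (cons_ne_nil _ _), hlast, hcast']
          simp [Nat.add_assoc, Nat.add_comm 1 k]
        · refine isChain_cons_cons.2 ⟨⟨hstep, ?_, ?_⟩, hchain⟩
          · show (i : ℝ) / N < ((i + 1 : ℕ) : ℝ) / N
            push_cast; gcongr; linarith
          · show ((i + 1 : ℕ) : ℝ) / N ≤ (i : ℝ) / N + 1 / N
            rw [hcast]
        · intro e he
          rcases mem_cons.1 he with rfl | he
          · exact ⟨ht0, (hvclose i).trans (by linarith)⟩
          · exact hmem' e he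
  -- the full walk `i = 0`, `k = N`
  obtain ⟨L, hL, hhead, hlast, hchain, hmem⟩ := main N 0 (by simp)
  obtain ⟨w₀, W, rfl⟩ : ∃ w₀ W, L = w₀ :: W := exists_cons_of_ne_nil hL
  simp only [head_cons, Nat.cast_zero, zero_div] at hhead
  have hW : W ≠ [] := by
    intro hWn
    subst hWn
    simp only [getLast_singleton, zero_add] at hlast
    rw [hhead] at hlast
    have := congrArg Prod.snd hlast
    simp only at this
    rw [div_self hN'.ne'] at this
    exact one_ne_zero this.symm
  refine ⟨w₀, W, hW, hchain, by rw [hhead], ?_, ?_, ?_⟩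
  · rw [getLast_cons hW] at hlast
    rw [hlast, hhead]
    simp only [zero_add]
    show nearestSite h (γ ((N : ℕ) / N)) = nearestSite h (γ ((0 : ℕ) / N))
    rw [Nat.cast_zero, zero_div, div_self hN'.ne', hloop]
  · rw [getLast_cons hW] at hlast
    rw [hlast]
    simp [div_self hN'.ne']
  · intro e he
    obtain ⟨⟨h1, h2⟩, h3⟩ := hmem e he
    simp only [Nat.cast_zero, zero_div, zero_add, div_self hN'.ne'] at h1 h2
    exact ⟨⟨h1, h2⟩, h3⟩

/-- Adjacency in `ℤ²` in coordinates: one coordinate moves by one, the other is fixed.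
[folklore] -/
theorem coord_of_zdGraph_adj {a b : Site 2} (h : (zdGraph 2).Adj a b) :
    ((b 0 = a 0 + 1 ∨ a 0 = b 0 + 1) ∧ b 1 = a 1) ∨ ((b 1 = a 1 + 1 ∨ a 1 = b 1 + 1) ∧ b 0 = a 0) := by
  obtain ⟨i, hi | hi⟩ := (zdGraph_adj_iff a b).1 h
  · have h0 := congrFun hi 0
    have h1 := congrFun hi 1
    fin_cases i
    · left; simp at h0 h1; exact ⟨Or.inl h0, h1⟩
    · right; simp at h0 h1; exact ⟨Or.inl h1, h0⟩
  · have h0 := congrFun hi 0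
    have h1 := congrFun hi 1
    fin_cases i
    · left; simp at h0 h1; exact ⟨Or.inr h0, h1.symm⟩
    · right; simp at h0 h1; exact ⟨Or.inr h1, h0.symm⟩

/-- Adjacent sites have mesh points with equal real parts or equal imaginary parts (the closed
edge between them is axis-parallel). [folklore] -/
theorem meshPoint_re_eq_or_im_eq_of_adj (h : ℝ) {a b : Site 2} (hab : (zdGraph 2).Adj a b) :
    (meshPoint h a).re = (meshPoint h b).re ∨ (meshPoint h a).im = (meshPoint h b).im := by
  rcases coord_of_zdGraph_adj hab with ⟨-, h1⟩ | ⟨-, h0⟩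
  · right; simp [meshPoint_im, h1]
  · left; simp [meshPoint_re, h0]

end RectilinearApproximation

end Summit.CriticalPhenomena.CardyFormulaZ2.Theorems
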